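import Summits.CriticalPhenomena.Ising3DConformalLimit.Theorems.PerfectScreeningSubharmonicOffOriginCcetDefs
import Summits.CriticalPhenomena.Ising3DConformalLimit.Theorems.PerfectScreeningSubharmonicOffOriginPlusBoundaryRP
import Summits.CriticalPhenomena.Ising3DConformalLimit.Theorems.LatticeSDPCertificatesCriticalStateFeasibleRP

/-!
# Crux `PerfectScreening.SubharmonicOffOrigin` (stmt-CriticalPhenomena-1341), line
`certified-core-eventual-tail`: stub `stub_plusState_feasible` (soundness of the relaxation)

This file proves the registered stub `stub_plusState_feasible` of the checked skeleton
`Cruxes/SubharmonicOffOrigin/Lines/certified_core_eventual_tail.lean` (objects `BracketRows`,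
`pairMoment` in `PerfectScreeningSubharmonicOffOriginCcetDefs`): for EVERY `β ≥ 0` and every
level `L`, some probability boundary law `ν` — the plus measure `μ⁺_{β,0}` itself — makes the
level-`L` Gibbs-inside functional `boundaryLawFunctional 3 L β ν` satisfy the six β-independent
rows `BracketRows L` (translation invariance inside the box, hyperoctahedral invariance,
reflection positivity in the four lattice mirror types, Griffiths I, the two Messager–Miracle-Solé
pair rows) and have pair moments `twoPointPlus 3 β`. In the composition `of_parts` of the line it
is `h2`; rows 1–6 at `β = β_c(3)` are item stmt-CriticalPhenomena-5506
(`exists_latticeBootstrapFeasible_plusCorr`), whose proofs of rows 1, 2, 4–6 are general in `β`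
and are repeated here.

Proof. `μ⁺_{β,0}` is a Gibbs measure, so `boundaryLawFunctional 3 L β μ⁺ = plusCorr 3 β 0` on all
finite sets (`exists_isGibbsMeasure_boundaryLawFunctional_eq_plusCorr`, Friedli–Velenik 2017,
eq. (6.12)). Rows: `plusCorr_map_shift`, `plusCorr_map_signedPerm`, `plusCorr_nonneg`,
`messager_miracleSole_holds`, `messager_miracleSole_diag_holds`; pair moments by
`twoPointPlus_eq_plusCorr_pair` (`{0} ∆ {y} = {0,y}`, `y ≠ 0`) and `E ∅ = 1 = ⟨σ₀σ₀⟩⁺`. The one new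
point is ROW 3 at general `β` (`plusCorr_fourMirror_rp`): the tree's
`plusCorr_criticalBeta_fourMirror_rp` realises `μ⁺` as the limit of FREE states, which needs
`m*(β) = 0`; here the `+`-BOUNDARY finite-volume states on the `θ`-symmetrised boxes
`Λ(L) ∪ θΛ(L)` are used instead — they are reflection positive through sites and bonds for every
`β ≥ 0` (Fröhlich–Israel–Lieb–Simon 1978, Thm. 3.1, for the `+` boundary condition:
`PerfectScreeningSubharmonicOffOriginPlusBoundaryRP`, sub-goal `plusRP_zd_sites`) and converge to
the plus state for every `β ≥ 0` by volume antitonicity (`tendsto_isingCorr_plus_symBox`), so no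
information on the magnetisation is needed (`plusRP_sum_sum_mul_plusCorr_symmDiff_nonneg`,
`plusRP_levelMirror`, `plusRP_bondMirror`; mirror geometry from
`HyperoctahedralRPCriticalCorrNineMirrorRP` / `LatticeSDPCertificatesCriticalStateFeasibleRP`).

References: J. Fröhlich, R. Israel, E. H. Lieb, B. Simon, Comm. Math. Phys. 62 (1978) 1–34;
S. Friedli, Y. Velenik, *Statistical Mechanics of Lattice Systems* (CUP 2017), Thm. 3.17,
Exercise 3.12, §6.2 eq. (6.12), Lemma 10.8; A. Messager, S. Miracle-Solé, J. Stat. Phys. 17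
(1977); G. C. Hegerfeldt, Comm. Math. Phys. 57 (1977); M. Cho, X. Sun, JHEP 11 (2023) 047,
Def. 12. No definitions are introduced.
-/

noncomputable section

namespace Summit.CriticalPhenomena.Ising3DConformalLimit.Theorems.PerfectScreening.Ccet

open Filter MeasureTheory Finset
open scoped Topology symmDiff
open Literature.Probability.LatticeModels Literature.Probability.Percolation
open Summit.CriticalPhenomena.Ising3DConformalLimit.LatticeSDPCertificatesFeasible

/-! ### From the `+`-boundary finite volumes to the plus state, for every `β ≥ 0` -/

section PlusState

variable {d : ℕ}

/-- **From finite-volume `+` reflection positivity to the plus state.** If the `+`-boundary Gibbs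
measures of the `θ`-symmetrised boxes `Λ(L) ∪ θΛ(L)` are reflection positive on the observable
`F = Σ_a c_a σ_{A_a}` and `β ≥ 0`, then `0 ≤ Σ_{a,b} c_a c_b ⟨σ_{A_a ∆ θA_b}⟩⁺_{β,0}`: expand
`(F ∘ θ^*) F = Σ_{a,b} c_a c_b σ_{θA_a ∆ A_b}` and pass to the limit `L → ∞`
(`tendsto_isingCorr_plus_symBox`: the `+` states along the symmetrised boxes converge to the plus
state for EVERY `β ≥ 0`, by volume antitonicity — no assumption on `m*(β)`). -/
theorem plusRP_sum_sum_mul_plusCorr_symmDiff_nonneg (θ : Site d ≃ Site d) {R : ℕ}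
    (hR : ∀ L, ∀ y ∈ box d L, θ y ∈ box d (L + R)) {β : ℝ} (hβ : 0 ≤ β)
    {m : ℕ} (A : Fin m → Finset (Site d)) (c : Fin m → ℝ)
    (hpos : ∀ L, 0 ≤ isingExpect (zdGraph d) (symBox θ L) β 0 .plus
      (fun τ => (∑ a, c a * spinProduct (A a) (configReflect θ τ)) *
        ∑ a, c a * spinProduct (A a) τ)) :
    0 ≤ ∑ a, ∑ b, c a * c b * plusCorr d β 0 (symmDiff (A a) ((A b).image θ)) := by
  classical
  set B : Fin m × Fin m → Finset (Site d) := fun p => ((A p.1).map θ.toEmbedding) ∆ (A p.2)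
    with hB
  have hexp : (fun τ : SpinConfig (Site d) =>
      (∑ a, c a * spinProduct (A a) (configReflect θ τ)) * ∑ a, c a * spinProduct (A a) τ) =
      fun τ => ∑ p : Fin m × Fin m, (c p.1 * c p.2) * spinProduct (B p) τ := by
    funext τ
    rw [Fintype.sum_prod_type, Finset.sum_mul_sum]
    refine Finset.sum_congr rfl fun a _ => Finset.sum_congr rfl fun b _ => ?_
    rw [spinProduct_configReflect_eq_map, mul_mul_mul_comm, spinProduct_mul_spinProduct]
  have hT : Tendsto (fun L => isingExpect (zdGraph d) (symBox θ L) β 0 .plus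
      (fun τ => (∑ a, c a * spinProduct (A a) (configReflect θ τ)) *
        ∑ a, c a * spinProduct (A a) τ))
      atTop (𝓝 (∑ p : Fin m × Fin m, (c p.1 * c p.2) * plusCorr d β 0 (B p))) := by
    rw [hexp]
    simp_rw [isingExpect_sum_mul_spinProduct]
    exact tendsto_finsetSum _ fun p _ =>
      (tendsto_isingCorr_plus_symBox hR hβ le_rfl (B p)).const_mul _
  calc (0 : ℝ) ≤ ∑ p : Fin m × Fin m, (c p.1 * c p.2) * plusCorr d β 0 (B p) :=
        ge_of_tendsto' hT hpos
    _ = ∑ a, ∑ b, c a * c b * plusCorr d β 0 (((A a).map θ.toEmbedding) ∆ (A b)) := by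
        rw [Fintype.sum_prod_type]
    _ = ∑ a, ∑ b, c b * c a * plusCorr d β 0 (symmDiff (A b) ((A a).image θ)) := by
        refine Finset.sum_congr rfl fun a _ => Finset.sum_congr rfl fun b _ => ?_
        rw [mul_comm (c a) (c b), Finset.map_eq_image, Equiv.coe_toEmbedding, symmDiff_comm]
    _ = ∑ a, ∑ b, c a * c b * plusCorr d β 0 (symmDiff (A a) ((A b).image θ)) :=
        Finset.sum_comm

/-- **Reflection positivity of the plus state through a site mirror with an integer level, every
`β ≥ 0`.** Let `θ` be an involutive automorphism of `ℤ^d` preserving the centred boxes and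
`ℓ : ℤ^d → ℤ` a level with `ℓ ∘ θ = -ℓ`, `θ = id` on `{ℓ = 0}` and `|ℓ x - ℓ y| ≤ 1` along edges.
Then for finite families `A_a ⊆ {ℓ ≥ 0}` and real `c_a`,
`0 ≤ Σ_{a,b} c_a c_b ⟨σ_{A_a ∆ θA_b}⟩⁺_{β,0}` (the `+`-boundary finite volumes `Λ(L) ∪ θΛ(L)` are
reflection positive through sites, `plusRP_isingExpect_reflect_mul_self_nonneg`, and the box
limit). -/
theorem plusRP_levelMirror (θ₀ : Site d → Site d) (hθ : Function.Involutive θ₀)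
    (hθG : ∀ x y, (zdGraph d).Adj x y → (zdGraph d).Adj (θ₀ x) (θ₀ y))
    (ℓ : Site d → ℤ) (hℓθ : ∀ x, ℓ (θ₀ x) = -ℓ x) (hfix : ∀ x, ℓ x = 0 → θ₀ x = x)
    (hadj : ∀ x y, (zdGraph d).Adj x y → ℓ x ≤ ℓ y + 1 ∧ ℓ y ≤ ℓ x + 1)
    (hbox : ∀ (L : ℕ) (x : Site d), x ∈ box d L → θ₀ x ∈ box d L)
    {β : ℝ} (hβ : 0 ≤ β) {m : ℕ} (A : Fin m → Finset (Site d)) (c : Fin m → ℝ)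
    (hA : ∀ a, ∀ p ∈ A a, 0 ≤ ℓ p) :
    0 ≤ ∑ a, ∑ b, c a * c b * plusCorr d β 0 (symmDiff (A a) ((A b).image θ₀)) := by
  classical
  let θe : Site d ≃ Site d := hθ.toPerm _
  have hθe : ∀ x, θe x = θ₀ x := fun x => rfl
  let P : Set (Site d) := {x | 0 ≤ ℓ x}
  have hmemP : ∀ x, x ∈ P ↔ 0 ≤ ℓ x := fun x => Iff.rfl
  have hmemθP : ∀ x, θe x ∈ P ↔ 0 ≤ -ℓ x := fun x => by rw [hmemP, hθe, hℓθ]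
  have H1 : ∀ x, x ∈ P ∨ θe x ∈ P := fun x => by
    rw [hmemP, hmemθP]
    omega
  have H2 : ∀ x ∈ P, θe x ∈ P → θe x = x := fun x hx hθx => by
    rw [hmemP] at hx
    rw [hmemθP] at hθx
    exact hfix x (by omega)
  have H3 : ∀ x y, (zdGraph d).Adj x y → (x ∈ P ∧ y ∈ P) ∨ (θe x ∈ P ∧ θe y ∈ P) :=
    fun x y hxy => by
      have h := hadj x y hxy
      rw [hmemP, hmemP, hmemθP, hmemθP]
      omega
  have hR : ∀ L, ∀ y ∈ box d L, θe y ∈ box d (L + 0) := fun L y hy => by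
    rw [Nat.add_zero]
    exact hbox L y hy
  exact plusRP_sum_sum_mul_plusCorr_symmDiff_nonneg θe hR hβ A c fun L =>
    plusRP_isingExpect_reflect_mul_self_nonneg (zdGraph d) θe hθ hθG
      (fun x => mem_symBox_iff hθ x) H1 H2 H3 β 0 (measurable_sum_mul_spinProduct A c)
      (dependsOn_sum_mul_spinProduct A c fun a p hp => (hmemP p).2 (hA a p hp))

/-- **Reflection positivity of the plus state through a bond mirror, every `β ≥ 0`.** For the
reflection of `ℤ^d` in the hyperplane `x_i = 1/2`: for finite families `A_a ⊆ {x_i ≥ 1}` and real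
`c_a`, `0 ≤ Σ_{a,b} c_a c_b ⟨σ_{A_a ∆ θA_b}⟩⁺_{β,0}` (the `+`-boundary finite volumes
`Λ(L) ∪ θΛ(L)` of the n.n. ferromagnet are reflection positive through bonds,
`plusRP_isingExpect_reflect_mul_self_nonneg_of_cross`, and the box limit). -/
theorem plusRP_bondMirror (i : Fin d) {β : ℝ} (hβ : 0 ≤ β) {m : ℕ}
    (A : Fin m → Finset (Site d)) (c : Fin m → ℝ) (hA : ∀ a, ∀ p ∈ A a, 1 ≤ p i) :
    0 ≤ ∑ a, ∑ b, c a * c b *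
      plusCorr d β 0 (symmDiff (A a) ((A b).image fun x => Function.update x i (1 - x i))) := by
  classical
  rw [bondMirror_eq_axisRefl]
  let P : Set (Site d) := {x | 1 ≤ x i}
  have hmemP : ∀ x, x ∈ P ↔ 1 ≤ x i := fun x => Iff.rfl
  have hP : ∀ x, x ∈ P ↔ axisRefl i 1 x ∉ P := fun x => by
    rw [hmemP, hmemP, axisRefl_apply, if_pos rfl]
    omega
  have hcross : ∀ x y, (zdGraph d).Adj x y → x ∈ P → y ∉ P → y = axisRefl i 1 x := by
    intro x y hxy hx hy
    rw [hmemP] at hx hy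
    obtain ⟨l, hl, hrest⟩ := zdGraph_adj_coord hxy
    funext j
    rw [axisRefl_apply]
    by_cases hj : j = i
    · subst hj
      rw [if_pos rfl]
      by_cases hlj : l = j
      · subst hlj
        omega
      · have := hrest j (Ne.symm hlj) ▸ hx
        omega
    · rw [if_neg hj]
      by_cases hlj : l = j
      · subst hlj
        have := hrest i (fun h => hj h.symm)
        omega
      · exact hrest j (Ne.symm hlj) ▸ rfl
  have hR : ∀ L, ∀ y ∈ box d L, axisRefl i 1 y ∈ box d (L + 1) := fun L y hy => by
    simpa using axisRefl_mem_box i 1 L y hy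
  exact plusRP_sum_sum_mul_plusCorr_symmDiff_nonneg (axisRefl i 1) hR hβ A c fun L =>
    plusRP_isingExpect_reflect_mul_self_nonneg_of_cross (zdGraph d) (axisRefl i 1)
      (axisRefl_involutive i 1) (fun x y h => (zdGraph_adj_axisRefl i 1 x y).2 h)
      (fun x => mem_symBox_iff (axisRefl_involutive i 1) x) hP hcross hβ 0
      (measurable_sum_mul_spinProduct A c)
      (dependsOn_sum_mul_spinProduct A c fun a p hp => (hmemP p).2 (hA a p hp))

end PlusState

/-! ### Row 3 for the plus state of `ℤ³` at every `β ≥ 0` -/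

open Summit.CriticalPhenomena.Ising3DConformalLimit.Cruxes.InversionUpgradeNormalised.FreeEndpointGaussianClosure
  in
open Summit.CriticalPhenomena.Ising3DConformalLimit.HyperoctahedralRPNineMirror in
/-- **Reflection positivity of the plus state of `ℤ³` in the four lattice mirror types, for EVERY
`β ≥ 0`** (site plane `x_i = 0`, bond plane `x_i = 1/2`, diagonal plane `x_i = x_j`, anti-diagonal
plane `x_i = -x_j`): `0 ≤ Σ_{a,b} c_a c_b ⟨σ_{A_a ∆ θA_b}⟩⁺_{β,0}` for finite families
`A_a ⊆ {ℓ ≥ 0}` — the general-`β` form of the tree's `plusCorr_criticalBeta_fourMirror_rp`, with the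
`+`-boundary finite-volume reflection positivity (Fröhlich–Israel–Lieb–Simon 1978, Thm. 3.1) in
place of the free one, so that no information on `m*(β)` is needed. -/
theorem plusCorr_fourMirror_rp {β : ℝ} (hβ : 0 ≤ β) {θ : Site 3 → Site 3} {ℓ : Site 3 → ℤ}
    (hθℓ : ∃ i j : Fin 3, i ≠ j ∧
      ((θ = fun x => Function.update x i (-x i)) ∧ (ℓ = fun x => x i) ∨
       (θ = fun x => Function.update x i (1 - x i)) ∧ (ℓ = fun x => 2 * x i - 1) ∨
       (θ = fun x => x ∘ Equiv.swap i j) ∧ (ℓ = fun x => x i - x j) ∨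
       (θ = fun x => Function.update (Function.update x i (-x j)) j (-x i)) ∧
         (ℓ = fun x => x i + x j)))
    {m : ℕ} (A : Fin m → Finset (Site 3)) (c : Fin m → ℝ) (hA : ∀ a, ∀ p ∈ A a, 0 ≤ ℓ p) :
    0 ≤ ∑ a, ∑ b, c a * c b * plusCorr 3 β 0 (symmDiff (A a) ((A b).image θ)) := by
  obtain ⟨i, j, hij, ⟨rfl, rfl⟩ | ⟨rfl, rfl⟩ | ⟨rfl, rfl⟩ | ⟨rfl, rfl⟩⟩ := hθℓ
  · -- coordinate mirror `x_i ↦ -x_i`, level `x_i`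
    refine plusRP_levelMirror _ (mirror_involutive i) (fun x y h => mirror_adj i h)
      (fun x => x i) (fun x => by simp) (fun x hx0 => ?_)
      (fun x y h => apply_le_add_one_of_adj i h) (fun L x hx => mirror_mem_box i hx) hβ A c hA
    have hx0' : x i = 0 := hx0
    rw [hx0', neg_zero, ← hx0', Function.update_eq_self]
  · -- bond mirror `x_i ↦ 1 - x_i`, level `2 x_i - 1`
    exact plusRP_bondMirror i hβ A c fun a p hp => by
      have h := hA a p hp
      dsimp only at h
      omega
  · -- diagonal mirror (swap), level `x_i - x_j`
    refine plusRP_levelMirror _ (swapMirror_involutive i j) (fun x y h => ?_)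
      (fun x => x i - x j) (fun x => ?_) (fun x hx0 => ?_)
      (fun x y h => sub_le_add_one_of_adj i j h) (fun L x hx => ?_) hβ A c hA
    · have h' := zdGraph_adj_signedPerm (Equiv.swap i j) 1 h
      rw [← swapMirror_eq_signedPerm] at h'
      exact h'
    · simp [Equiv.swap_apply_left, Equiv.swap_apply_right]
    · have hx0' : x i - x j = 0 := hx0
      funext l
      simp only [Function.comp_apply]
      by_cases hli : l = i
      · subst hli; rw [Equiv.swap_apply_left]; omega
      · by_cases hlj : l = j
        · subst hlj; rw [Equiv.swap_apply_right]; omega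
        · rw [Equiv.swap_apply_of_ne_of_ne hli hlj]
    · have h' := (signedPerm_mem_box_iff (Equiv.swap i j) 1 (n := L) (x := x)).2 hx
      rw [← swapMirror_eq_signedPerm] at h'
      exact h'
  · -- anti-diagonal mirror, level `x_i + x_j`
    refine plusRP_levelMirror _ (antiMirror_involutive hij) (fun x y h => ?_)
      (fun x => x i + x j) (fun x => ?_) (fun x hx0 => ?_)
      (fun x y h => add_le_add_one_of_adj hij h) (fun L x hx => ?_) hβ A c hA
    · have h' := zdGraph_adj_signedPerm (Equiv.swap i j)
        (fun l => if l = i ∨ l = j then -1 else 1) h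
      rw [← antiMirror_eq_signedPerm hij] at h'
      exact h'
    · simp [Function.update_of_ne hij, add_comm]
    · have hx0' : x i + x j = 0 := hx0
      funext l
      by_cases hlj : l = j
      · subst hlj
        rw [Function.update_self]
        omega
      · by_cases hli : l = i
        · subst hli
          rw [Function.update_of_ne hlj, Function.update_self]
          omega
        · rw [Function.update_of_ne hlj, Function.update_of_ne hli]
    · have h' := (signedPerm_mem_box_iff (Equiv.swap i j)
        (fun l => if l = i ∨ l = j then -1 else 1) (n := L) (x := x)).2 hx
      rw [← antiMirror_eq_signedPerm hij] at h'
      exact h'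

/-! ### Rows 1–6 for the plus state at every `β ≥ 0`, and the stub -/

/-- **The six β-independent rows hold for the plus correlations `⟨σ_A⟩⁺_{β,0}` of `ℤ³` at every
`β ≥ 0` and every level**: translation invariance (`plusCorr_map_shift`), hyperoctahedral
invariance (`plusCorr_map_signedPerm`), four-mirror reflection positivity
(`plusCorr_fourMirror_rp`), Griffiths' first inequality (`plusCorr_nonneg`) and the two
Messager–Miracle-Solé pair rows (`messager_miracleSole_holds`, `messager_miracleSole_diag_holds`,
pair form via `twoPointPlus_eq_plusCorr_pair`); rows 1, 2, 4–6 verbatim as in the tree's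
`exists_latticeBootstrapFeasible_plusCorr` (item stmt-CriticalPhenomena-5506, `β = β_c(3)`). -/
theorem bracketRows_plusCorr {β : ℝ} (hβ : 0 ≤ β) (L : ℕ) : BracketRows L (plusCorr 3 β 0) := by
  refine ⟨?_, ?_, ?_, ?_, ?_, ?_⟩
  · -- row 1: translation invariance inside the box (in fact everywhere)
    intro A v _ _
    have h := plusCorr_map_shift (d := 3) hβ 0 A v
    have hs : ⇑(Site.shift v) = (· + v) := funext (Site.shift_apply v)
    rw [Finset.map_eq_image, Equiv.coe_toEmbedding, hs] at h
    exact h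
  · -- row 2: signed coordinate permutations
    intro A π s _
    have h := plusCorr_map_signedPerm (d := 3) π.symm s β 0 A
    have hs : ⇑(Site.signedPerm π.symm s) = fun (x : Site 3) (i : Fin 3) => (s i : ℤ) * x (π i) := by
      funext x i
      simp [Site.signedPerm_apply]
    rw [Finset.map_eq_image, Equiv.coe_toEmbedding, hs] at h
    exact h
  · -- row 3: reflection positivity, four mirror types
    intro θ ℓ hθℓ m A c hA
    exact plusCorr_fourMirror_rp hβ hθℓ A c fun a p hp => (hA a).2 p hp
  · -- row 4: Griffiths' first inequality
    intro A _
    exact plusCorr_nonneg hβ le_rfl A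
  · -- row 5: Messager–Miracle-Solé along the axes
    intro x i hx hxi _ _
    have hx' : x + Pi.single i 1 ≠ 0 := by
      intro h
      have h1 := congr_fun h i
      simp only [Pi.add_apply, Pi.single_eq_same, Pi.zero_apply] at h1
      omega
    rw [← twoPointPlus_eq_plusCorr_pair _ hx', ← twoPointPlus_eq_plusCorr_pair _ hx]
    exact messager_miracleSole_holds hβ x i hxi
  · -- row 6: Messager–Miracle-Solé away from the diagonals
    intro x i j hij hx hxji _ _
    have hx' : x + Pi.single i 1 - Pi.single j 1 ≠ 0 := by
      intro h
      have h1 := congr_fun h i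
      have h2 := congr_fun h j
      simp only [Pi.add_apply, Pi.sub_apply, Pi.single_eq_same, Pi.zero_apply,
        Pi.single_eq_of_ne hij, Pi.single_eq_of_ne hij.symm] at h1 h2
      omega
    rw [← twoPointPlus_eq_plusCorr_pair _ hx', ← twoPointPlus_eq_plusCorr_pair _ hx]
    exact messager_miracleSole_diag_holds hβ x hij hxji

/-- **Stub `stub_plusState_feasible` of the line `certified-core-eventual-tail` (soundness: the plus
state is a feasible point at every level, with its own pair moments).** For every `β ≥ 0` and
level `L`, the plus measure `μ⁺_{β,0}` — a probability measure and an infinite-volume Gibbs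
measure (`exists_plusMeasure_holds`), so that by the DLR equations its level-`L` Gibbs-inside
functional is `boundaryLawFunctional 3 L β μ⁺ = plusCorr 3 β 0` on ALL finite sets
(`exists_isGibbsMeasure_boundaryLawFunctional_eq_plusCorr`, Friedli–Velenik 2017, eq. (6.12)) —
satisfies `BracketRows L` (`bracketRows_plusCorr`) and has pair moments
`pairMoment E y = ⟨σ₀σ_y⟩⁺_β = twoPointPlus 3 β y` (`{0} ∆ {y} = {0, y}` for `y ≠ 0`,
`twoPointPlus_eq_plusCorr_pair`; `{0} ∆ {0} = ∅`, `E ∅ = 1 = ⟨σ₀σ₀⟩⁺`). -/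
theorem stub_plusState_feasible :
    ∀ β : ℝ, 0 ≤ β → ∀ L : ℕ,
      ∃ ν : Measure (SpinConfig (Site 3)), IsProbabilityMeasure ν ∧
        BracketRows L (boundaryLawFunctional 3 L β ν) ∧
        ∀ y : Site 3, pairMoment (boundaryLawFunctional 3 L β ν) y = twoPointPlus 3 β y := by
  intro β hβ L
  obtain ⟨μ, hμ, -, hcorr⟩ :=
    exists_isGibbsMeasure_boundaryLawFunctional_eq_plusCorr (d := 3) hβ
  haveI : IsProbabilityMeasure μ := hμ.isProbabilityMeasure
  refine ⟨μ, inferInstance, ?_, fun y => ?_⟩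
  · have hE : boundaryLawFunctional 3 L β μ = plusCorr 3 β 0 := funext fun A => hcorr L A
    rw [hE]
    exact bracketRows_plusCorr hβ L
  · by_cases hy : y = 0
    · subst hy
      rw [pairMoment_zero, boundaryLawFunctional_empty, twoPointPlus_origin]
    · rw [pairMoment_of_ne_zero _ y hy, hcorr L, twoPointPlus_eq_plusCorr_pair β hy]

end Summit.CriticalPhenomena.Ising3DConformalLimit.Theorems.PerfectScreening.Ccet

end
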